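import Mathlib
import HarnessLib
import Summits.NavierStokesRegularity.NavierStokesRegularity.Theorems.PoloidalWindowDoorPoloidalWindowRigidityUntwistedStuartTranslation3

/-!
# Route `PoloidalWindowDoor`, crux `PoloidalWindowRigidity` (K2, stmt-NavierStokesRegularity-19708), skeleton `lrc-jet` v5,
# stub `stub_untwisted` — brick F4-tr-d (part 4): BRANCH 2b FROM THE DIVERGENCE IDENTITY

Cell ns-regularity-ideate, K2 lead ns-poloidal-K2-p1 (gen 6; `--supports stmt-NavierStokesRegularity-19708`, helper; UNTWISTED-NOTE §3 (2b)).
`branch2b_false_of_divIdentity`: as `…UntwistedStuartTranslation3.branch2b_false`, with the consistency relation `Λ·ċ = (Ld + ΛPw)·c` replaced by its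
source, the divergence identity `(K1) Λ·Δₕw + Λ_w·|∇ₕw|² + c(w,y₂) = 0` with `c = DP(·)(P,1)` (brick F3a's hypothesis `hK1` with this `c`): the relation
follows pointwise from `(K1)`, its height-derivative (`…UntwistedSeparation.vert_deriv_divIdentity`) and `D₁ = 0`.  This is the form the assembly of
`stub_untwisted` calls on the region where both Wronskians `D₁`, `D₃` vanish identically.

WHAT THIS IS NOT: not a claim about Navier–Stokes — calculus bookkeeping (bears_on LADDER-NS N0 via crux K2 = stmt-19708).
-/

noncomputable section

-- the summit and its single sub-problem share the name (CONVENTIONS §1), as in every Theorems file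
set_option linter.dupNamespace false

namespace Summit.NavierStokesRegularity.NavierStokesRegularity.Theorems.PoloidalWindowDoorPoloidalWindowRigidityUntwistedBranch2b

open Set Function Filter Topology Metric
open Summit.NavierStokesRegularity.NavierStokesRegularity.Theorems.PoloidalWindowDoorPoloidalWindowRigidityUntwistedSeparation
open Summit.NavierStokesRegularity.NavierStokesRegularity.Theorems.PoloidalWindowDoorPoloidalWindowRigidityUntwistedStuartTranslationAnalytic
open Summit.NavierStokesRegularity.NavierStokesRegularity.Theorems.PoloidalWindowDoorPoloidalWindowRigidityUntwistedStuartTranslation3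

variable {w : EuclideanSpace ℝ (Fin 3) → ℝ} {P Λ : ℝ × ℝ → ℝ} {U : Set (EuclideanSpace ℝ (Fin 3))}
  {y₀ : EuclideanSpace ℝ (Fin 3)} {b : Fin 3}

/-- **Branch 2b from the divergence identity.**  As `branch2b_false`, with the consistency relation replaced by its source: the divergence
identity `(K1) Λ·Δₕw + Λ_w·|∇ₕw|² + c(w,y₂) = 0` with `c = DP(·)(P,1)` (brick F3a's `hK1` with this `c`); the relation `Λ·ċ = (Ld + ΛPw)·c`
follows from `(K1)`, its height-derivative (`vert_deriv_divIdentity`) and `D₁ = 0`. [folklore] -/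
theorem branch2b_false_of_divIdentity (hU : IsOpen U) (hy₀ : y₀ ∈ U) (hb : b ≠ 2)
    (hwA : AnalyticOnNhd ℝ w univ)
    (hPA : ∀ y ∈ U, AnalyticAt ℝ P (w y, y 2)) (hΛA : ∀ y ∈ U, AnalyticAt ℝ Λ (w y, y 2))
    (hP : ∀ y ∈ U, fderiv ℝ w y (EuclideanSpace.single 2 (1 : ℝ)) = P (w y, y 2))
    (hbne : ∀ y ∈ U, fderiv ℝ w y (EuclideanSpace.single b (1 : ℝ)) ≠ 0)
    (hL0 : ∀ y ∈ U, Λ (w y, y 2) ≠ 0) (hL1 : ∀ y ∈ U, Λ (w y, y 2) ≠ 1)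
    (hK1 : ∀ y ∈ U, Λ (w y, y 2) *
        (fderiv ℝ (fun y' => fderiv ℝ w y' (EuclideanSpace.single 0 (1 : ℝ))) y (EuclideanSpace.single 0 (1 : ℝ)) +
          fderiv ℝ (fun y' => fderiv ℝ w y' (EuclideanSpace.single 1 (1 : ℝ))) y (EuclideanSpace.single 1 (1 : ℝ))) +
      fderiv ℝ Λ (w y, y 2) (1, 0) * (fderiv ℝ w y (EuclideanSpace.single 0 (1 : ℝ)) ^ 2 + fderiv ℝ w y (EuclideanSpace.single 1 (1 : ℝ)) ^ 2) +
        fderiv ℝ P (w y, y 2) (P (w y, y 2), 1) = 0)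
    (hD1 : ∀ y ∈ U,
      Λ (w y, y 2) * (Λ (w y, y 2) * fderiv ℝ (fun q => fderiv ℝ P q ((1 : ℝ), (0 : ℝ))) (w y, y 2) (1, 0) +
            fderiv ℝ (fun q => fderiv ℝ Λ q ((1 : ℝ), (0 : ℝ))) (w y, y 2) (P (w y, y 2), 1) +
            2 * fderiv ℝ Λ (w y, y 2) (1, 0) * fderiv ℝ P (w y, y 2) (1, 0)) -
          fderiv ℝ Λ (w y, y 2) (1, 0) * (fderiv ℝ Λ (w y, y 2) (P (w y, y 2), 1) + Λ (w y, y 2) * fderiv ℝ P (w y, y 2) (1, 0)) = 0)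
    (hD3 : ∀ y ∈ U,
      (Λ (w y, y 2) * (1 - Λ (w y, y 2))) *
            (Λ (w y, y 2) * (1 - Λ (w y, y 2)) * Λ (w y, y 2) +
              fderiv ℝ (fun q => fderiv ℝ Λ q ((1 : ℝ), (0 : ℝ))) (w y, y 2) (P (w y, y 2), 1) +
              2 * fderiv ℝ Λ (w y, y 2) (1, 0) * fderiv ℝ P (w y, y 2) (1, 0)) -
          fderiv ℝ Λ (w y, y 2) (1, 0) *
            ((1 - 2 * Λ (w y, y 2)) * fderiv ℝ Λ (w y, y 2) (P (w y, y 2), 1) +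
              Λ (w y, y 2) * (1 - Λ (w y, y 2)) * fderiv ℝ P (w y, y 2) (1, 0)) = 0) : False := by
  have hw : ContDiff ℝ 3 w := hwA.contDiff
  have hP2 : ∀ y ∈ U, ContDiffAt ℝ 2 P (w y, y 2) := fun y hy => (hPA y hy).contDiffAt
  have hΛ2 : ∀ y ∈ U, ContDiffAt ℝ 2 Λ (w y, y 2) := fun y hy => (hΛA y hy).contDiffAt
  -- `c = DP(P,1)` is differentiable at the leaf points
  have hcd : ∀ y ∈ U, DifferentiableAt ℝ (fun q : ℝ × ℝ => fderiv ℝ P q (P q, 1)) (w y, y 2) := fun y hy =>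
    (analyticAt_structure (hPA y hy) (hΛA y hy) (hL0 y hy) (hL1 y hy)).2.2.1.differentiableAt
  refine branch2b_false hU hy₀ hb hwA hPA hΛA hP hbne hL0 hL1 hD1 (fun y hy => ?_) hD3
  have hK1' := vert_deriv_divIdentity (c := fun q : ℝ × ℝ => fderiv ℝ P q (P q, 1)) hU hw hP2 hΛ2 hcd hP hK1 hy
  have h1 := hK1 y hy
  have hd := hD1 y hy
  linear_combination Λ (w y, y 2) * hK1' -
    (fderiv ℝ Λ (w y, y 2) (P (w y, y 2), 1) + Λ (w y, y 2) * fderiv ℝ P (w y, y 2) (1, 0)) * h1 -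
    (fderiv ℝ w y (EuclideanSpace.single 0 (1 : ℝ)) ^ 2 + fderiv ℝ w y (EuclideanSpace.single 1 (1 : ℝ)) ^ 2) * hd


end Summit.NavierStokesRegularity.NavierStokesRegularity.Theorems.PoloidalWindowDoorPoloidalWindowRigidityUntwistedBranch2b

end
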